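import Summits.BirchSwinnertonDyer.BirchSwinnertonDyer.Theorems.PrintCf2RubinValueTwoColemanCoinvariantCharClosure
import Literature.NumberTheory.EllipticCurves.PAdicTwoVariableUnitsClosure
import HarnessLib

/-!
# Brick (c) at `p = 2`, local `χ`-part, GENERATED FORM: for `𝒞̄ :=` THE CLOSURE OF THE GROUP GENERATED BY a family of principal coherent tower units
# `β_𝔠` (de Shalit's `𝒞_𝔣`, III §1.4), **`char_Λ ((N / Col 𝒞̄)_ε) = char_Λ (Λ / (L_ε))`** from: the levelwise relation II §2.4 (ii), the Galois translates
# of the generators lying in `𝒞̄`, two auxiliary indices, and `L_ε ≠ 0` — all six set-theoretic hypotheses of the one-stop form DISCHARGED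

Cell `bsd-print-cf2`, width seat `bsd-line-cf2c-w7` g13, route C `PrintCf2RubinValueTwo`, crux of record stmt-BirchSwinnertonDyer-24033
`TwoVariableMainConjAtSplitTwoQuad` (23720 nominal), BRICK §4(c); `--supports` the crux as a helper.  THEOREMS ONLY (0 sorry, no named fact, no
`def … : Prop`); Theses-free.  BSD is not proved by any of this.

`PrintCf2RubinValueTwoColemanCoinvariantCharClosure.charIdeal_coinvariants_colemanImage_eq_of_units` (g13 S17) took a SET `C` with the six hypotheses of
`colemanImageSubmodule` (closed, `⊆ 𝒰¹_∞`, `∋ 1`, products, inverses, `Γ_F`) plus `C ⊆ closure ⟨β_c^{±1}⟩`.  With `Literature/…/PAdicTwoVariableUnitsClosure`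
(g13 S18a) all six hold for **`C := closure ⟨β_c^{±1}⟩`** itself, given only that the `β_c` are principal coherent and that the Galois translates
`σ̃·β_c` (`σ̃ ∈ Γ_F`) lie in that closure (for the elliptic units: II §2.4 (ii) `e(𝔞)^{σ_𝔠} = e(𝔞𝔠)e(𝔠)^{−N𝔞}` on Artin symbols + density):

* ★★★ `charIdeal_coinvariants_colemanImage_closure_eq_of_units` — **`char_Λ ((N / Col 𝒞̄)_ε) = char_Λ (𝒪_F⟦X⟧⟦T⟧ ⧸ (L_ε))`**;
* ★★ `map_colemanImageSubmodule₁_closure_eq` — **`φ_ε(Col 𝒞̄) = (L_ε)·J_ε`** (III §1.4 (5) `i(𝒞̄_𝔣) = μ(𝔣)Λ₀`, `ε`-part, one prime);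
* ★★ `exists_charIdeal_coinvariants_colemanImage_closure_eq_of_units` — `L_ε` produced from the levelwise unit relation.

Remaining named inputs for de Shalit III (17) at one prime above `2`: the measure lane's `β_𝔞 = (e(𝔞)_{𝔓,m})_m ∈ 𝒰¹_∞` with `hrel_ellipticUnitsLocal` at
every level and the translate property; `L_ε ≠ 0`; `Λ` factorial for `char(Λ/(L)) = (L)`.

## References
* [deShalit1987] E. de Shalit, *Iwasawa theory of elliptic curves with complex multiplication* (1987), II §2.4 (ii), §4.12 (29)–(33); III §1.4 (5),
  Cor. 1.5 (7), Lemma 1.10 (17).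
* [Washington1997] L. C. Washington, *Introduction to Cyclotomic Fields* (1997), §13.2.
-/

noncomputable section

set_option linter.dupNamespace false
set_option autoImplicit false

open Filter Topology
open scoped PowerSeries.WithPiTopology

namespace Summit.BirchSwinnertonDyer.BirchSwinnertonDyer.Theorems.PrintCf2.ColemanCoinvariantGenerated

open Literature.NumberTheory.GaloisRepresentations Literature.NumberTheory.GaloisRepresentations.IsNonarchimedeanLocalField
  Literature.NumberTheory.GaloisRepresentations.LubinTate ValuativeRel Field
open Literature.NumberTheory.EllipticCurves
open Summit.BirchSwinnertonDyer.BirchSwinnertonDyer.Theorems.PrintCf2.ColemanImage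
open Summit.BirchSwinnertonDyer.BirchSwinnertonDyer.Theorems.PrintCf2.ColemanCoinvariantClosure

variable {F : Type} [Field F] [ValuativeRel F] [TopologicalSpace F] [IsNonarchimedeanLocalField F]

attribute [local instance] ltNormUniformSpace ltNormIsUniformAddGroup rk1 nF nE fintypeResidueField
attribute [local instance] RelNormCoherentUnits.instCommMonoid

variable {p : ℕ} [hp : Fact p.Prime] {d : ℕ} (hd : d.Coprime p)
variable {π : 𝒪[F]} (hπ : (valuation F).IsUniformizer (π : F))
variable (E : ℕ → IntermediateField F (AlgebraicClosure F)) [∀ m, FiniteDimensional F (E m)] [∀ m, Normal F (E m)]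
  [∀ m, IsGalois F (E m)] (hmono : Monotone E) (hE : ∀ m, E m ≤ maxUnramified F) (hdeg : ∀ m, Module.finrank F (E m) = d * p ^ m)
  {σ₀ : absoluteGaloisGroup F} (hσ₀ : IsAbsArithFrob σ₀) (hq : residueFieldCard F = 2)
variable (u : (LTCoeff F)ˣ) (hu : LTCoeff.of F π = residueFieldCard F * u) (γ w : 𝒪[F]ˣ) (hγ : (γ : 𝒪[F]) = 1 + π ^ 2 * w)
variable [IsAdicComplete (Ideal.span {intBase F (LTCoeff.of F π)}) (PowerSeries 𝒪[F])] [NeZero d]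
variable {θ : ∀ m, unitBall (E m)} (hθ : ∀ m, IsIntegralNormalGen (E m) (θ m))
  (hcoh : ∀ m, unitBallTrace (hmono (Nat.le_succ m)) (θ (m + 1)) = θ m)
variable [CharZero F] [IsAdicComplete (Ideal.span {(p : 𝒪[F])}) 𝒪[F]] (hI : Ideal.span {(p : 𝒪[F])} ≠ ⊤)
  (hud : ∀ m, (u : LTCoeff F) ^ Module.finrank F (E m) ≠ 1) (hm : ∃ m₁ : ℕ, LTCoeff.of F π ^ 2 ∣ LTCoeff.of F π - m₁)
variable [Unique (ZMod d)] (hN : DenseRange (Nat.cast : ℕ → 𝒪[F]))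
variable {I : Type*} (β : I → ∀ m, RelNormCoherentUnits hπ (E m)) (hβ : ∀ c, β c ∈ principalCoherentFamilies hπ E hmono)
  (hgen : ∀ (σ : absoluteGaloisGroup F) (c : I), (fun m => ((β c) m).galAct σ) ∈
    closure (Submonoid.closure (Set.range β ∪ Set.range fun c => fun m => ((β c) m).inv hπ (E m)) : Set (∀ m, RelNormCoherentUnits hπ (E m))))
variable (ε : PowerSeries (PowerSeries 𝒪[F])) (σ : I → absoluteGaloisGroup F) (n : I → ℕ)

omit [CharZero F] in
include hdeg in
/-- ★★ **`φ_ε(Col 𝒞̄) = (L_ε)·J_ε`** for `𝒞̄ = closure ⟨β_c^{±1}⟩` (de Shalit III §1.4 (5), `ε`-part, one prime): from `φ_ε(Col β_c) = (t_{χ(σ̃_c)} − n_c)·L_ε` for every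
`c`. [cite: deShalit1987, III §1.4 (5); II §4.12 (33)] [cite: Washington1997, §13.2] -/
theorem map_colemanImageSubmodule₁_closure_eq (L : PowerSeries (PowerSeries 𝒪[F]))
    (hL : ∀ c : I, colemanDeltaCoinvFun hπ hq (intBase F) u hu γ (eq_zero_of_C_pi_mul_eq_zero_integer hπ) w hγ ε
        (colemanImage hd hπ E hmono hE hdeg hσ₀ hq u hu γ hθ hcoh
          (closure_unitsGen_subset_principalCoherentFamilies hπ E hmono β hβ (mem_closure_unitsGen hπ E β c)).1 default) =
      (colemanDeltaCoinvFun hπ hq (intBase F) u hu γ (eq_zero_of_C_pi_mul_eq_zero_integer hπ) w hγ ε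
          (unitTwistₗ hπ hq (intBase F) u hu γ (lubinTateChar hπ (σ c)) (TActModule.ofPS _ _ 1)) -
        PowerSeries.C ((n c : ℕ) : PowerSeries 𝒪[F])) * L) :
    (colemanImageSubmodule₁ hd hπ E hmono hE hdeg hσ₀ hq u hu γ hθ hcoh hN
        (closure (Submonoid.closure (Set.range β ∪ Set.range fun c => fun m => ((β c) m).inv hπ (E m)) : Set (∀ m, RelNormCoherentUnits hπ (E m))))
        isClosed_closure (closure_unitsGen_subset_principalCoherentFamilies hπ E hmono β hβ) (one_mem_closure_unitsGen hπ E β)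
        (mul_mem_closure_unitsGen hπ E β) (inv_mem_closure_unitsGen hπ E β) (galAct_mem_closure_unitsGen hπ E β hgen)).map
        (colemanDeltaCoinvFun hπ hq (intBase F) u hu γ (eq_zero_of_C_pi_mul_eq_zero_integer hπ) w hγ ε) =
      Ideal.span {L} * Ideal.span (Set.range fun c =>
        colemanDeltaCoinvFun hπ hq (intBase F) u hu γ (eq_zero_of_C_pi_mul_eq_zero_integer hπ) w hγ ε
            (unitTwistₗ hπ hq (intBase F) u hu γ (lubinTateChar hπ (σ c)) (TActModule.ofPS _ _ 1)) -
          PowerSeries.C ((n c : ℕ) : PowerSeries 𝒪[F])) :=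
  map_colemanImageSubmodule₁_eq hd hπ E hmono hE hdeg hσ₀ hq u hu γ w hγ hθ hcoh hN _ isClosed_closure
    (closure_unitsGen_subset_principalCoherentFamilies hπ E hmono β hβ) (one_mem_closure_unitsGen hπ E β)
    (mul_mem_closure_unitsGen hπ E β) (inv_mem_closure_unitsGen hπ E β) (galAct_mem_closure_unitsGen hπ E β hgen) β
    (mem_closure_unitsGen hπ E β) ε σ n subset_rfl L hL

include hdeg hE hσ₀ hcoh hm in
/-- ★★★ **THE LOCAL (c)-IDENTITY, GENERATED FORM** (`q = 2`, one prime, `d = 1`, `ε`-part; de Shalit III §1.4 (5) + Lemma 1.10 (17)): for principal coherent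
tower families `β_c` whose Galois translates lie in `𝒞̄ = closure ⟨β_c^{±1}⟩`, under the auxiliary indices `a₁` (`χ(σ̃_{a₁}) = γ`, `π ∣ n_{a₁} − 1`), `a₂`
(`(t_{χ(σ̃_{a₂})} − n_{a₂})(n_{a₁} − 1) ≠ 0`) and `L_ε ≠ 0` with `φ_ε(Col β_c) = (t_{χ(σ̃_c)} − n_c)·L_ε` for every `c`:
**`char_Λ ((N / Col 𝒞̄)_ε) = char_Λ (Λ ⧸ (L_ε))`**, `N = Col(𝒰¹_∞)`, `Λ = 𝒪_F⟦X⟧⟦T⟧`. [cite: deShalit1987, III §1.4 (5), Cor. 1.5 (7), Lemma 1.10 (17); II §4.12 (33)]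
[cite: Washington1997, §13.2] -/
theorem charIdeal_coinvariants_colemanImage_closure_eq_of_units (hε : ε * ε = 1)
    (a₁ a₂ : I) (hv₁ : lubinTateChar hπ (σ a₁) = γ) (hn₁ : (π : 𝒪[F]) ∣ (n a₁ : 𝒪[F]) - 1)
    (ha₂ : tEval (natCast_sub_one_mem_span_intBase (F := F) hn₁)
      (colemanDeltaCoinvFun hπ hq (intBase F) u hu γ (eq_zero_of_C_pi_mul_eq_zero_integer hπ) w hγ ε
          (unitTwistₗ hπ hq (intBase F) u hu γ (lubinTateChar hπ (σ a₂)) (TActModule.ofPS _ _ 1)) -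
        PowerSeries.C ((n a₂ : ℕ) : PowerSeries 𝒪[F])) ≠ 0)
    (L : PowerSeries (PowerSeries 𝒪[F])) (hL0 : L ≠ 0)
    (hL : ∀ c : I, colemanDeltaCoinvFun hπ hq (intBase F) u hu γ (eq_zero_of_C_pi_mul_eq_zero_integer hπ) w hγ ε
        (colemanImage hd hπ E hmono hE hdeg hσ₀ hq u hu γ hθ hcoh
          (closure_unitsGen_subset_principalCoherentFamilies hπ E hmono β hβ (mem_closure_unitsGen hπ E β c)).1 default) =
      (colemanDeltaCoinvFun hπ hq (intBase F) u hu γ (eq_zero_of_C_pi_mul_eq_zero_integer hπ) w hγ ε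
          (unitTwistₗ hπ hq (intBase F) u hu γ (lubinTateChar hπ (σ c)) (TActModule.ofPS _ _ 1)) -
        PowerSeries.C ((n c : ℕ) : PowerSeries 𝒪[F])) * L) :
    Module.charIdeal (PowerSeries (PowerSeries 𝒪[F]))
        (↥(unitsImage₁ hd hπ E hmono hE hdeg hσ₀ hq u hu γ hθ hcoh hI hud) ⧸
          colemanCoinvRel hπ hq (intBase F) u hu γ ε (unitsImage₁ hd hπ E hmono hE hdeg hσ₀ hq u hu γ hθ hcoh hI hud)
            (fun _ hG => unitTwistₗ_mem_unitsImage₁ hd hπ E hmono hE hdeg hσ₀ hq u hu γ hθ hcoh hI hud (-1) hG)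
            (colemanImageSubmodule₁ hd hπ E hmono hE hdeg hσ₀ hq u hu γ hθ hcoh hN
              (closure (Submonoid.closure (Set.range β ∪ Set.range fun c => fun m => ((β c) m).inv hπ (E m)) :
                Set (∀ m, RelNormCoherentUnits hπ (E m))))
              isClosed_closure (closure_unitsGen_subset_principalCoherentFamilies hπ E hmono β hβ) (one_mem_closure_unitsGen hπ E β)
              (mul_mem_closure_unitsGen hπ E β) (inv_mem_closure_unitsGen hπ E β) (galAct_mem_closure_unitsGen hπ E β hgen))) =
      Module.charIdeal (PowerSeries (PowerSeries 𝒪[F])) (PowerSeries (PowerSeries 𝒪[F]) ⧸ Ideal.span {L}) :=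
  charIdeal_coinvariants_colemanImage_eq_of_units hd hπ E hmono hE hdeg hσ₀ hq u hu γ w hγ hθ hcoh hI hud hm hN _ isClosed_closure
    (closure_unitsGen_subset_principalCoherentFamilies hπ E hmono β hβ) (one_mem_closure_unitsGen hπ E β)
    (mul_mem_closure_unitsGen hπ E β) (inv_mem_closure_unitsGen hπ E β) (galAct_mem_closure_unitsGen hπ E β hgen) β
    (mem_closure_unitsGen hπ E β) ε σ n hε subset_rfl a₁ a₂ hv₁ hn₁ ha₂ L hL0 hL

include hdeg hE hσ₀ hcoh hm in
/-- ★★ **Existence form**: under the LEVELWISE unit relation (II §2.4 (ii); `σ̃_c` fixing `E_∞`) and the two auxiliary indices, THE series `L_ε` exists,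
`φ_ε(Col 𝒞̄) = (L_ε)·J_ε`, and — if `L_ε ≠ 0` — `char_Λ ((N / Col 𝒞̄)_ε) = char_Λ (Λ/(L_ε))`. [cite: deShalit1987, II §2.4 (ii), §4.12 (29)–(33); III §1.4 (5), Lemma 1.10 (17)] -/
theorem exists_charIdeal_coinvariants_colemanImage_closure_eq_of_units (hε : ε * ε = 1)
    (hσE : ∀ (i : I) (m : ℕ) (x : E m), σ i • (x : AlgebraicClosure F) = x)
    (hrel : ∀ (a c : I) (m : ℕ), ((β a) m).galAct (σ c) * (β c) m ^ n a = ((β c) m).galAct (σ a) * (β a) m ^ n c)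
    (a₁ a₂ : I) (hv₁ : lubinTateChar hπ (σ a₁) = γ) (hn₁ : (π : 𝒪[F]) ∣ (n a₁ : 𝒪[F]) - 1)
    (ha₂ : tEval (natCast_sub_one_mem_span_intBase (F := F) hn₁)
      (colemanDeltaCoinvFun hπ hq (intBase F) u hu γ (eq_zero_of_C_pi_mul_eq_zero_integer hπ) w hγ ε
          (unitTwistₗ hπ hq (intBase F) u hu γ (lubinTateChar hπ (σ a₂)) (TActModule.ofPS _ _ 1)) -
        PowerSeries.C ((n a₂ : ℕ) : PowerSeries 𝒪[F])) ≠ 0) :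
    ∃ L : PowerSeries (PowerSeries 𝒪[F]),
      (∀ c : I, colemanDeltaCoinvFun hπ hq (intBase F) u hu γ (eq_zero_of_C_pi_mul_eq_zero_integer hπ) w hγ ε
          (colemanImage hd hπ E hmono hE hdeg hσ₀ hq u hu γ hθ hcoh
            (closure_unitsGen_subset_principalCoherentFamilies hπ E hmono β hβ (mem_closure_unitsGen hπ E β c)).1 default) =
        (colemanDeltaCoinvFun hπ hq (intBase F) u hu γ (eq_zero_of_C_pi_mul_eq_zero_integer hπ) w hγ ε
            (unitTwistₗ hπ hq (intBase F) u hu γ (lubinTateChar hπ (σ c)) (TActModule.ofPS _ _ 1)) -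
          PowerSeries.C ((n c : ℕ) : PowerSeries 𝒪[F])) * L) ∧
      (colemanImageSubmodule₁ hd hπ E hmono hE hdeg hσ₀ hq u hu γ hθ hcoh hN
          (closure (Submonoid.closure (Set.range β ∪ Set.range fun c => fun m => ((β c) m).inv hπ (E m)) :
            Set (∀ m, RelNormCoherentUnits hπ (E m))))
          isClosed_closure (closure_unitsGen_subset_principalCoherentFamilies hπ E hmono β hβ) (one_mem_closure_unitsGen hπ E β)
          (mul_mem_closure_unitsGen hπ E β) (inv_mem_closure_unitsGen hπ E β) (galAct_mem_closure_unitsGen hπ E β hgen)).map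
          (colemanDeltaCoinvFun hπ hq (intBase F) u hu γ (eq_zero_of_C_pi_mul_eq_zero_integer hπ) w hγ ε) =
        Ideal.span {L} * Ideal.span (Set.range fun c =>
          colemanDeltaCoinvFun hπ hq (intBase F) u hu γ (eq_zero_of_C_pi_mul_eq_zero_integer hπ) w hγ ε
              (unitTwistₗ hπ hq (intBase F) u hu γ (lubinTateChar hπ (σ c)) (TActModule.ofPS _ _ 1)) -
            PowerSeries.C ((n c : ℕ) : PowerSeries 𝒪[F])) ∧
      (L ≠ 0 → Module.charIdeal (PowerSeries (PowerSeries 𝒪[F]))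
          (↥(unitsImage₁ hd hπ E hmono hE hdeg hσ₀ hq u hu γ hθ hcoh hI hud) ⧸
            colemanCoinvRel hπ hq (intBase F) u hu γ ε (unitsImage₁ hd hπ E hmono hE hdeg hσ₀ hq u hu γ hθ hcoh hI hud)
              (fun _ hG => unitTwistₗ_mem_unitsImage₁ hd hπ E hmono hE hdeg hσ₀ hq u hu γ hθ hcoh hI hud (-1) hG)
              (colemanImageSubmodule₁ hd hπ E hmono hE hdeg hσ₀ hq u hu γ hθ hcoh hN
                (closure (Submonoid.closure (Set.range β ∪ Set.range fun c => fun m => ((β c) m).inv hπ (E m)) :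
                  Set (∀ m, RelNormCoherentUnits hπ (E m))))
                isClosed_closure (closure_unitsGen_subset_principalCoherentFamilies hπ E hmono β hβ) (one_mem_closure_unitsGen hπ E β)
                (mul_mem_closure_unitsGen hπ E β) (inv_mem_closure_unitsGen hπ E β) (galAct_mem_closure_unitsGen hπ E β hgen))) =
        Module.charIdeal (PowerSeries (PowerSeries 𝒪[F])) (PowerSeries (PowerSeries 𝒪[F]) ⧸ Ideal.span {L})) :=
  exists_charIdeal_coinvariants_colemanImage_eq_of_units hd hπ E hmono hE hdeg hσ₀ hq u hu γ w hγ hθ hcoh hI hud hm hN _ isClosed_closure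
    (closure_unitsGen_subset_principalCoherentFamilies hπ E hmono β hβ) (one_mem_closure_unitsGen hπ E β)
    (mul_mem_closure_unitsGen hπ E β) (inv_mem_closure_unitsGen hπ E β) (galAct_mem_closure_unitsGen hπ E β hgen) β
    (mem_closure_unitsGen hπ E β) ε σ n hε subset_rfl hσE hrel a₁ a₂ hv₁ hn₁ ha₂

end Summit.BirchSwinnertonDyer.BirchSwinnertonDyer.Theorems.PrintCf2.ColemanCoinvariantGenerated

end
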